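import Literature.NumberTheory.ConnesConsani2021.ArchKernelTier2PanelsSound
import Literature.NumberTheory.ConnesConsani2021.ArchKernelSigmaTMSound
import Literature.NumberTheory.ConnesConsani2021.ArchKernelL1Assembly
import Literature.NumberTheory.ConnesConsani2021.ArchKernelTier2PanelsFlat0
import Literature.NumberTheory.ConnesConsani2021.ArchKernelTier2PanelsFlat1
import Literature.NumberTheory.ConnesConsani2021.ArchKernelTier2PanelsFlat2
import Literature.NumberTheory.ConnesConsani2021.ArchKernelTier2PanelsFlat3
import Literature.NumberTheory.ConnesConsani2021.ArchKernelTier2PanelsFlat4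
import Literature.NumberTheory.ConnesConsani2021.ArchKernelTier2PanelsFlat5
import Literature.NumberTheory.ConnesConsani2021.ArchKernelTier2PanelsFlat6
import Literature.NumberTheory.ConnesConsani2021.ArchKernelTier2PanelsFlat7
import Literature.NumberTheory.ConnesConsani2021.ArchKernelTier2PanelsFlat8
import Literature.NumberTheory.ConnesConsani2021.ArchKernelTier2PanelsFlat9
import Literature.NumberTheory.ConnesConsani2021.ArchKernelTier2PanelsFlat10
import Literature.NumberTheory.ConnesConsani2021.ArchKernelTier2PanelsFlat11
import Literature.NumberTheory.ConnesConsani2021.ArchKernelTier2PanelsFlat12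
import Literature.NumberTheory.ConnesConsani2021.ArchKernelTier2PanelsFlat13
import Literature.NumberTheory.ConnesConsani2021.ArchKernelTier2PanelsFlat14
import Literature.NumberTheory.ConnesConsani2021.ArchKernelTier2PanelsFlat15
import HarnessLib

/-!
# (E-a) Tier 2 — ASSEMBLY: `CC2021_section6_enclosures` from the kernel certificate, modulo the two remaining read-backs

RH-FREE certified-numerics bookkeeping (cell rh-crit, seat rh-crit-cc-iso g4; director-rh 2026-08-26T09:43:03Z (α) lift;
cc-lead R119/R132: entry point of record = t7 g3's `ArchKernelL1Assembly.section6_enclosures_of_tier2`).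
Inputs wired here (all LANDED): the 64 flat kernel facts `ArchCertT2.panelFlat_K` (`ArchKernelTier2PanelsFlat0..15`),
the σ-model read-back `ArchCertSigma.tmem_sigmaTM_et` (`ArchKernelSigmaTMSound`, t7/t12), the panel read-back
`ArchCertT2.tier2_hM_of` (`ArchKernelTier2PanelsSound`, this seat), and the closing rational inequality `hcheck`
(decided here: LHS ≈ 8.81·10⁻⁴ ≤ ε₁ = 1/400).  Inputs taken as HYPOTHESES (their files are in flight in the consortium,
cc-lead R132): (T2b-sound) `h8` — the S₈ Taylor-model enclosure of the stub family `s8TM hQ 6 (centre K) combinedLit`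
(t4 g4 assembler + eng-1 (O-a) + gm-t16 (F1/F2)); (T2e) `he` — the slope window `eLoNum/2¹²⁸ ≤ ε′(1₊) ≤ eHiNum/2¹²⁸`
(from `ArchKernelModesMISound.slopeFine_real` + the index-free tail frame).  When both land, `CC2021_section6_enclosures_holds`
is the one-line instantiation, and K3 closes by `CCRouteAdapters.windowSpectralBound_of_section6` (p431843).
WHAT THIS IS NOT: a discharge of (E-a) (two hypotheses remain), nor any claim about RH; nothing here bears on the truth of RH.
-/

noncomputable section

open Real Set MeasureTheory
open Literature.Analysis.ValidatedNumerics.NumericsMP Literature.Analysis.ValidatedNumerics.PolyMP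
open Literature.NumberTheory.ConnesConsani2021.ArchCert (S eLoNum eHiNum)
open Literature.NumberTheory.ConnesConsani2021.ArchCertSigma (sigmaTM hQ)

namespace Literature.NumberTheory.ConnesConsani2021.ArchCertT2

open Literature.NumberTheory.LFunctions

/-- The stub S₈-model family of record (`ArchKernelTier2Panels`). [cite: ConnesConsani2021, Prop. 5.3 p. 32; §6.3 p. 24 (in-kernel (E-a) certificate)] -/
def s8Stub (K : ℕ) : IPoly := (s8TM hQ 6 (centre K) combinedLit).getD []

/-- **The 64 flat kernel facts, packaged**: `∀ K < 64, subSups (tsubI (sigmaTM K) (s8Stub K)) = panelM[K]`.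
[cite: ConnesConsani2021, §6.4 Fact 6.1 + Lemma 6.3 p. 24 (in-kernel (E-a) certificate)] -/
theorem hP_flat : ∀ K < 64, subSups (tsubI (sigmaTM K) (s8Stub K)) = panelM.getD K [] := by
  intro K hK
  unfold s8Stub
  match K, hK with
  | 0, _ => exact panelFlat_0
  | 1, _ => exact panelFlat_1
  | 2, _ => exact panelFlat_2
  | 3, _ => exact panelFlat_3
  | 4, _ => exact panelFlat_4
  | 5, _ => exact panelFlat_5
  | 6, _ => exact panelFlat_6
  | 7, _ => exact panelFlat_7
  | 8, _ => exact panelFlat_8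
  | 9, _ => exact panelFlat_9
  | 10, _ => exact panelFlat_10
  | 11, _ => exact panelFlat_11
  | 12, _ => exact panelFlat_12
  | 13, _ => exact panelFlat_13
  | 14, _ => exact panelFlat_14
  | 15, _ => exact panelFlat_15
  | 16, _ => exact panelFlat_16
  | 17, _ => exact panelFlat_17
  | 18, _ => exact panelFlat_18
  | 19, _ => exact panelFlat_19
  | 20, _ => exact panelFlat_20
  | 21, _ => exact panelFlat_21
  | 22, _ => exact panelFlat_22
  | 23, _ => exact panelFlat_23
  | 24, _ => exact panelFlat_24
  | 25, _ => exact panelFlat_25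
  | 26, _ => exact panelFlat_26
  | 27, _ => exact panelFlat_27
  | 28, _ => exact panelFlat_28
  | 29, _ => exact panelFlat_29
  | 30, _ => exact panelFlat_30
  | 31, _ => exact panelFlat_31
  | 32, _ => exact panelFlat_32
  | 33, _ => exact panelFlat_33
  | 34, _ => exact panelFlat_34
  | 35, _ => exact panelFlat_35
  | 36, _ => exact panelFlat_36
  | 37, _ => exact panelFlat_37
  | 38, _ => exact panelFlat_38
  | 39, _ => exact panelFlat_39
  | 40, _ => exact panelFlat_40
  | 41, _ => exact panelFlat_41
  | 42, _ => exact panelFlat_42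
  | 43, _ => exact panelFlat_43
  | 44, _ => exact panelFlat_44
  | 45, _ => exact panelFlat_45
  | 46, _ => exact panelFlat_46
  | 47, _ => exact panelFlat_47
  | 48, _ => exact panelFlat_48
  | 49, _ => exact panelFlat_49
  | 50, _ => exact panelFlat_50
  | 51, _ => exact panelFlat_51
  | 52, _ => exact panelFlat_52
  | 53, _ => exact panelFlat_53
  | 54, _ => exact panelFlat_54
  | 55, _ => exact panelFlat_55
  | 56, _ => exact panelFlat_56
  | 57, _ => exact panelFlat_57
  | 58, _ => exact panelFlat_58
  | 59, _ => exact panelFlat_59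
  | 60, _ => exact panelFlat_60
  | 61, _ => exact panelFlat_61
  | 62, _ => exact panelFlat_62
  | 63, _ => exact panelFlat_63
  | n + 64, h => omega

/-- `et` of record (`= ArchCertSigma.twoEtNum/(2·twoEtDen) = 22.996475683870528`). [cite: ConnesConsani2021, Lemma 5.4 p. 33 (ε′(1₊) ≃ 22.9965)] -/
def etQ : ℚ := 22996475683870528 / 10 ^ 15

/-- `e⁻ = eLoNum·2⁻¹²⁸` as a rational. [cite: ConnesConsani2021, Lemma 5.4 p. 33] -/
def eloQ : ℚ := (eLoNum : ℚ) / 2 ^ 128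
/-- `e⁺ = eHiNum·2⁻¹²⁸` as a rational. [cite: ConnesConsani2021, Lemma 5.4 p. 33] -/
def ehiQ : ℚ := (eHiNum : ℚ) / 2 ^ 128

/-- `twoEt/2 = etQ`. [cite: ConnesConsani2021, Lemma 5.4 p. 33] -/
theorem twoEt_div_two : twoEt / 2 = etQ := by
  simp only [twoEt, etQ, ArchCertSigma.twoEtNum, ArchCertSigma.twoEtDen]; norm_num

/-- **hM for the data of record, given the S₈ read-back**: t7's hypothesis with `m = 2048`, `M = panelMQ`, `et = etQ`.
[cite: ConnesConsani2021, §6.4 Fact 6.1 + Lemma 6.3 p. 24 (in-kernel (E-a) certificate); §6.3 p. 24] -/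
theorem tier2_hM
    (h8 : ∀ K < 64, TMem S hQ (fun u ↦ S8 (Real.exp (cK K + u))) (s8Stub K)) :
    ∀ k : ℕ, k < 2048 → ∀ w ∈ Icc ((k : ℝ) * Real.log 2 / 2048) (((k + 1 : ℕ) : ℝ) * Real.log 2 / 2048),
      |2 * (etQ : ℝ) * (SpectralCert.frameKernel (-(Real.log 2 / 2)) (Real.log 2 / 2)
            SpectralCert.CertAF.N (fun n ↦ (SpectralCert.CertAF.c n : ℝ)) w).re
        - ∑ n ∈ Finset.range 8, sonineQTerm (prolateFun n) (prolateEigen n) (Real.exp w)|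
        ≤ (panelMQ k : ℝ) := by
  have hσ : ∀ K < 64, TMem S hQ (fun u ↦ 2 * ((twoEt / 2 : ℚ) : ℝ) * (tauC (cK K + u)).re) (sigmaTM K) := by
    intro K _
    have h := ArchCertSigma.tmem_sigmaTM_et K
    rw [twoEt_div_two]
    refine fun u hu ↦ ?_
    obtain ⟨as, has, hev⟩ := h u hu
    refine ⟨as, has, ?_⟩
    rw [← hev]
    simp only [tauC, cK, etQ]
  intro k hk w hw
  have h := tier2_hM_of s8Stub hP_flat hσ h8 k hk w hw
  rw [twoEt_div_two] at h
  simpa only [tauC, S8] using h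

set_option maxRecDepth 200000 in
/-- **The closing rational inequality of the certificate** (`hcheck` of `section6_enclosures_of_tier2` with `elo = etQ`
(NOTE: eng-1's `et` lies ≈1.7e-15 BELOW the fine slope window `[eLoNum, eHiNum]·2⁻¹²⁸`, so the frame is fed the slightly
wider window `[etQ, ehiQ]`, which costs nothing),
`ehi = ehiQ`, `m = 2048`, `M = panelMQ`, `T = 7/5000`): LHS ≈ 8.81·10⁻⁴ ≤ ε₁ = 1/400. [cite: ConnesConsani2021, §6.4 Fact 6.1 + Lemma 6.3 p. 24 (in-kernel (E-a) certificate)] -/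
theorem hcheck_tier2 :
    (6931471808 / 10 ^ 10 : ℚ) * ((1 / etQ) * ((∑ k ∈ Finset.range 2048, panelMQ k) / 2048
        + (2 * (ehiQ - etQ) * 6 + 7 / 5000))) ≤ SpectralCert.CertAF.ε₁ := by
  have hsum : (∑ k ∈ Finset.range 2048, panelMQ k) =
      (19386406156870955179816431879009767195318 : ℚ) / (S : ℚ) := by
    decide +kernel
  rw [hsum]
  simp only [etQ, ehiQ, ArchCert.eHiNum, SpectralCert.CertAF.ε₁, ArchCert.S]
  norm_num

/-- **`CC2021_section6_enclosures` from the Tier-2 certificate**, modulo (T2b-sound) `h8` and (T2e) `he`.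
[cite: ConnesConsani2021, §6.4 Fact 6.1 + Lemma 6.3 p. 24; §6.7 Lemma 6.10 / Thm. 6.11 p. 28] -/
theorem section6_enclosures_of_tier2_inputs
    (h8 : ∀ K < 64, TMem S hQ (fun u ↦ S8 (Real.exp (cK K + u))) (s8Stub K))
    (he : (eloQ : ℝ) ≤ ∑' n : ℕ, epsSlopeTerm (prolateFun n) ∧ ∑' n : ℕ, epsSlopeTerm (prolateFun n) ≤ (ehiQ : ℝ)) :
    CC2021_section6_enclosures :=
  have hle : (etQ : ℝ) ≤ (eloQ : ℝ) := by
    simp only [etQ, eloQ, ArchCert.eLoNum]; norm_num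
  section6_enclosures_of_tier2 (elo := etQ) (ehi := ehiQ) (et := etQ) (m := 2048) (M := panelMQ)
    (by simp only [etQ]; norm_num) ⟨hle.trans he.1, he.2⟩
    (by simp only [ehiQ, etQ, ArchCert.eHiNum]; norm_num) (by norm_num)
    (tier2_hM h8) hcheck_tier2

end Literature.NumberTheory.ConnesConsani2021.ArchCertT2

end
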